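import Literature.MathematicalPhysics.QuantumFieldTheory.Balaban1983to89.Beta.LogDetHessian
import Literature.MathematicalPhysics.QuantumFieldTheory.Balaban1983to89.Beta.GaugeFixing
import Literature.AlgebraicGeometry.HodgeTheory.LeviForm

/-!
# `BalabanUV.Beta.TwoJetPolarization` — row D1 ∕ (C1), RULING R-D1-g56-1 (C-4) ∕ ADDENDUM -A (A6): **THE ONE-LOOP POLARIZATION SEES ONLY THE
# 2-JET OF ITS DATA AT `B = 0`; THE PROJECTOR FAMILY** (part 1 of the 2-jet bridge; part 2 = `CombSlicePairJetBridge`)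

WHAT ([folklore] finite-dimensional calculus over the tree's one-loop model `LogDetHessian.Family`; literal-agnostic; nothing cited, no
`Prop`-valued definition — the three recurring hypothesis shapes are LOCAL NOTATIONS, spelled out in every statement):
* §1 `J2Z[f]` (notation) — `f` is `C²` at `0` with vanishing value, first and second derivative there; closed under `+`, `−`, finite sums
  and multiplication by a `C²` function (Leibniz to second order, via `Literature.AlgebraicGeometry.HodgeTheory.fderiv_fderiv_mul_apply`);
  kills `hessianAt`.
* §2 entrywise matrix calculus: `EC2[M]` (every entry `C²` at `0`), `EJ2Z[M]` (every entry `J2Z`), closed under products (one `EJ2Z` factor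
  suffices); an `EJ2Z` map vanishes at `0`.
* §3 `polarization_eq_of_sub_jet2Zero` — `Beta.polarization` sees only the 2-jet of the data at `0`: two families with `C²` entries whose
  `Q`- and `Δ`-differences are `EJ2Z`, one of them with nondegenerate bordered matrix at `0`, have the same polarization
  (`LogDetHessian`'s Jacobi formula `Family.polarization_eq_trace` on both sides).
* §4 the PROJECTOR FAMILY `projFamily F W L := (Q·Π, Πᵀ·Δ·Π)`, `Π = 1 − W·L` for ANY `C²` left inverse `L(B)` of `W(B)` (`L·W = 1`): it
  satisfies the dictionary clauses (c1) `Δ·W = 0` (two-sided) and (c2) `Q·W = 0` EXACTLY at every `B`, and differs from `F` by terms each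
  carrying a factor `Δ·W`, `Δᵀ·W` or `Q·W` — hence by `EJ2Z` matrices when those three products are.
WHY: the by-value gate AT-0 of (III″) certifies (c1)(c2) only as 2-jets at `0`; `CombSlicePairJetBridge` (part 2) turns that into the exact
hypothesis of `CombSlicePairPolarization` using §3–§4.  WHAT THIS IS NOT: no model of the literal's concrete data; nothing of Bałaban's
asserted, valued or discharged; 0 estimates; RECORD (ROOT M‴) unchanged; NOT D1, NEVER «G-an2-4 closed», NOT BetaPertH, NOT continuum, NOT Clay.

HONEST DEPENDENCY (page 1, mandatory): continuum YM on T⁴ ⇐ BetaPertH ∧ nine spine estimates (0/9 proved); BetaPertH ⇐ (D1) ∧ (D4) ∧ CAP+tail;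
G-an2-4 gates asym, D1 and NE2/3/4.  Row D1 ∕ (C1) OWNER an2, gen 56, 2026-08-25.  No existing file touched.
-/

noncomputable section

namespace Summit.QuantumFields.BalabanUV.Beta.TwoJetPolarization

open Literature.MathematicalPhysics.QuantumFieldTheory.Balaban1983to89.Beta
open Literature.MathematicalPhysics.QuantumFieldTheory.Balaban1983to89.Beta.GaugeFixing
open Literature.AlgebraicGeometry.HodgeTheory (fderiv_fderiv_mul_apply fderiv_fderiv_add_apply)
open Matrix

variable {ι : Type*} [Fintype ι] [DecidableEq ι]

/-- `J2Z[f]`: `f` is `C²` at `0` and its value, first and second derivative at `0` vanish (hypothesis shape, spelled out). -/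
local notation "J2Z[" f "]" =>
  (ContDiffAt ℝ 2 f 0 ∧ f 0 = 0 ∧ fderiv ℝ f 0 = 0 ∧ fderiv ℝ (fderiv ℝ f) 0 = 0)

set_option quotPrecheck false in
/-- `EC2[M]`: every entry of the matrix-valued map `M` is `C²` at `0` (hypothesis shape, spelled out). -/
local notation "EC2[" M "]" => (∀ i j, ContDiffAt ℝ 2 (fun B => M B i j) 0)

set_option quotPrecheck false in
/-- `EJ2Z[M]`: every entry of the matrix-valued map `M` satisfies `J2Z` (hypothesis shape, spelled out). -/
local notation "EJ2Z[" M "]" => (∀ i j, J2Z[fun B => M B i j])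

/-! ## §1. Functions of the background with vanishing 2-jet at `0` -/

section Jets

variable {f g : (ι → ℝ) → ℝ}

omit [DecidableEq ι] in
/-- [folklore] The zero function has vanishing 2-jet. -/
theorem jet2Zero_zero : J2Z[fun _ : ι → ℝ => (0 : ℝ)] := by
  refine ⟨contDiffAt_const, rfl, ?_, ?_⟩
  · exact fderiv_const_apply 0
  · have h : fderiv ℝ (fun _ : ι → ℝ => (0 : ℝ)) = fun _ => 0 := by
      funext x; exact fderiv_const_apply 0
    rw [h]; exact fderiv_const_apply 0

omit [DecidableEq ι] in
/-- [folklore] Sums of functions with vanishing 2-jet. -/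
theorem jet2Zero_add (hf : J2Z[f]) (hg : J2Z[g]) : J2Z[fun B => f B + g B] := by
  refine ⟨hf.1.add hg.1, by simp [hf.2.1, hg.2.1], ?_, ?_⟩
  · rw [fderiv_fun_add (hf.1.differentiableAt two_ne_zero) (hg.1.differentiableAt two_ne_zero), hf.2.2.1, hg.2.2.1,
      add_zero]
  · ext u v
    have h := fderiv_fderiv_add_apply hf.1 hg.1 u v
    have e1 : (fun y => fderiv ℝ (fun z => f z + g z) y) = fderiv ℝ (fun B => f B + g B) := rfl
    have e2 : (fun y => fderiv ℝ f y) = fderiv ℝ f := rfl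
    have e3 : (fun y => fderiv ℝ g y) = fderiv ℝ g := rfl
    rw [e1, e2, e3, hf.2.2.2, hg.2.2.2] at h
    simpa using h

omit [DecidableEq ι] in
/-- [folklore] Negation. -/
theorem jet2Zero_neg (hf : J2Z[f]) : J2Z[fun B => -f B] := by
  refine ⟨hf.1.neg, by simp [hf.2.1], ?_, ?_⟩
  · rw [show (fun B => -f B) = -f from rfl, fderiv_neg, hf.2.2.1, neg_zero]
  · have h : fderiv ℝ (fun B => -f B) = -fderiv ℝ f := by
      funext x; rw [show (fun B => -f B) = -f from rfl, fderiv_neg]; rfl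
    rw [h, fderiv_neg, hf.2.2.2, neg_zero]

omit [DecidableEq ι] in
/-- [folklore] Differences. -/
theorem jet2Zero_sub (hf : J2Z[f]) (hg : J2Z[g]) : J2Z[fun B => f B - g B] := by
  simpa [sub_eq_add_neg] using jet2Zero_add hf (jet2Zero_neg hg)

omit [DecidableEq ι] in
/-- [folklore] LEIBNIZ TO SECOND ORDER: a product ONE of whose factors has vanishing 2-jet, the other being `C²`, has vanishing 2-jet. -/
theorem jet2Zero_mul (hf : J2Z[f]) (hg : ContDiffAt ℝ 2 g 0) : J2Z[fun B => f B * g B] := by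
  refine ⟨hf.1.mul hg, by simp [hf.2.1], ?_, ?_⟩
  · rw [fderiv_fun_mul (hf.1.differentiableAt two_ne_zero) (hg.differentiableAt two_ne_zero), hf.2.1, hf.2.2.1, zero_smul,
      smul_zero, add_zero]
  · ext u v
    have h := fderiv_fderiv_mul_apply hf.1 hg u v
    have e1 : (fun y => fderiv ℝ (fun z => f z * g z) y) = fderiv ℝ (fun B => f B * g B) := rfl
    have e2 : (fun y => fderiv ℝ f y) = fderiv ℝ f := rfl
    rw [e1, e2, hf.2.1, hf.2.2.1, hf.2.2.2] at h
    simpa using h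

omit [DecidableEq ι] in
/-- [folklore] … in either order. -/
theorem jet2Zero_mul_left (hg : ContDiffAt ℝ 2 g 0) (hf : J2Z[f]) : J2Z[fun B => g B * f B] := by
  simpa [mul_comm] using jet2Zero_mul hf hg

omit [DecidableEq ι] in
/-- [folklore] Finite sums. -/
theorem jet2Zero_sum {α : Type*} (s : Finset α) {f : α → (ι → ℝ) → ℝ} (h : ∀ k ∈ s, J2Z[f k]) :
    J2Z[fun B => ∑ k ∈ s, f k B] := by
  classical
  induction s using Finset.induction_on with
  | empty => simpa using (jet2Zero_zero : J2Z[fun _ : ι → ℝ => (0 : ℝ)])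
  | @insert a s ha ih =>
    have h1 : J2Z[f a] := h a (Finset.mem_insert_self a s)
    have h2 := ih fun k hk => h k (Finset.mem_insert_of_mem hk)
    have := jet2Zero_add h1 h2
    simpa [Finset.sum_insert ha] using this

/-- [folklore] A vanishing 2-jet kills the Hessian entries of `Beta.OneLoop`. -/
theorem hessianAt_eq_zero_of_jet2Zero (hf : J2Z[f]) (i j : ι) : hessianAt f i j = 0 := by
  unfold hessianAt
  rw [iteratedFDeriv_two_apply, hf.2.2.2]
  rfl

end Jets

/-! ## §2. Entrywise matrix calculus -/

section Entrywise

variable {a b c : Type*}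
variable {M M' : (ι → ℝ) → Matrix a b ℝ} {N : (ι → ℝ) → Matrix b c ℝ}

omit [DecidableEq ι] in
/-- [folklore] Products of `C²` matrix maps. -/
theorem entryC2_mul [Fintype b] (hM : EC2[M]) (hN : EC2[N]) : EC2[fun B => M B * N B] := by
  intro i j
  simp only [Matrix.mul_apply]
  exact ContDiffAt.sum fun k _ => (hM i k).mul (hN k j)

omit [DecidableEq ι] in
/-- [folklore] A product whose LEFT factor has vanishing 2-jets and whose right factor is `C²` has vanishing 2-jets. -/
theorem entryJet2Zero_mul_right [Fintype b] (hM : EJ2Z[M]) (hN : EC2[N]) : EJ2Z[fun B => M B * N B] := by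
  intro i j
  have := jet2Zero_sum (Finset.univ : Finset b) (f := fun k B => M B i k * N B k j) fun k _ => jet2Zero_mul (hM i k) (hN k j)
  simpa [Matrix.mul_apply] using this

omit [DecidableEq ι] in
/-- [folklore] A product whose RIGHT factor has vanishing 2-jets and whose left factor is `C²` has vanishing 2-jets. -/
theorem entryJet2Zero_mul_left [Fintype b] {M : (ι → ℝ) → Matrix a b ℝ} {N : (ι → ℝ) → Matrix b c ℝ} (hM : EC2[M])
    (hN : EJ2Z[N]) : EJ2Z[fun B => M B * N B] := by
  intro i j
  have := jet2Zero_sum (Finset.univ : Finset b) (f := fun k B => M B i k * N B k j) fun k _ =>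
    jet2Zero_mul_left (hM i k) (hN k j)
  simpa [Matrix.mul_apply] using this

omit [DecidableEq ι] in
/-- [folklore] The value at `0` of a map with vanishing 2-jets is `0`. -/
theorem apply_zero_of_entryJet2Zero (hM : EJ2Z[M]) : M 0 = 0 := by
  ext i j; exact (hM i j).2.1

end Entrywise

/-! ## §3. The polarization sees only the 2-jet of the data at `0` -/

section TwoJet

variable {n m : ℕ}

/-- [folklore] **THE POLARIZATION IS A FUNCTION OF THE 2-JET OF `(Q, Δ)` AT `0`.**  Two background families with `C²` entries whose `Q`- and
`Δ`-differences have vanishing 2-jets at `0`, the first with nondegenerate bordered matrix at `0`, have the same polarization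
(`LogDetHessian`'s `Family.polarization_eq_trace` on both sides). -/
theorem polarization_eq_of_sub_jet2Zero (F G : Family ι n m)
    (hFQ : EC2[fun B => (F B).Q]) (hFΔ : EC2[fun B => (F B).Δ]) (hGQ : EC2[fun B => (G B).Q]) (hGΔ : EC2[fun B => (G B).Δ])
    (hdet : (F 0).kkt.det ≠ 0)
    (hQ : EJ2Z[fun B => (G B).Q - (F B).Q]) (hΔ : EJ2Z[fun B => (G B).Δ - (F B).Δ]) :
    polarization F = polarization G := by
  -- values at 0
  have hQ0 : (G 0).Q = (F 0).Q := sub_eq_zero.mp (apply_zero_of_entryJet2Zero hQ)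
  have hΔ0 : (G 0).Δ = (F 0).Δ := sub_eq_zero.mp (apply_zero_of_entryJet2Zero hΔ)
  have hK0 : (G 0).kkt = (F 0).kkt := by
    rw [ConstrainedGaussian.kkt, ConstrainedGaussian.kkt, hQ0, hΔ0]
  have hdetG : (G 0).kkt.det ≠ 0 := by rw [hK0]; exact hdet
  -- first variations
  have hdQ : ∀ i, G.dQ i = F.dQ i := by
    intro i; ext p q
    have h1 : DifferentiableAt ℝ (fun B => (F B).Q p q) 0 := (hFQ p q).differentiableAt two_ne_zero
    have h2 : DifferentiableAt ℝ (fun B => (G B).Q p q - (F B).Q p q) 0 := (hQ p q).1.differentiableAt two_ne_zero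
    have h3 : fderiv ℝ (fun B => (G B).Q p q - (F B).Q p q) 0 = 0 := (hQ p q).2.2.1
    have hsplit : (fun B => (G B).Q p q) = fun B => (F B).Q p q + ((G B).Q p q - (F B).Q p q) := by
      funext B; ring
    simp only [Family.dQ, Matrix.of_apply]
    rw [hsplit, fderiv_fun_add h1 h2, h3, add_zero]
  have hdΔ : ∀ i, G.dΔ i = F.dΔ i := by
    intro i; ext p q
    have h1 : DifferentiableAt ℝ (fun B => (F B).Δ p q) 0 := (hFΔ p q).differentiableAt two_ne_zero
    have h2 : DifferentiableAt ℝ (fun B => (G B).Δ p q - (F B).Δ p q) 0 := (hΔ p q).1.differentiableAt two_ne_zero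
    have h3 : fderiv ℝ (fun B => (G B).Δ p q - (F B).Δ p q) 0 = 0 := (hΔ p q).2.2.1
    have hsplit : (fun B => (G B).Δ p q) = fun B => (F B).Δ p q + ((G B).Δ p q - (F B).Δ p q) := by
      funext B; ring
    simp only [Family.dΔ, Matrix.of_apply]
    rw [hsplit, fderiv_fun_add h1 h2, h3, add_zero]
  -- second variations
  have hd2Q : ∀ i j, G.d2Q i j = F.d2Q i j := by
    intro i j; ext p q
    have h1 : ContDiffAt ℝ 2 (fun B => (F B).Q p q) 0 := hFQ p q
    have h2 : ContDiffAt ℝ 2 (fun B => (G B).Q p q - (F B).Q p q) 0 := (hQ p q).1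
    have h3 : hessianAt (fun B => (G B).Q p q - (F B).Q p q) i j = 0 := hessianAt_eq_zero_of_jet2Zero (hQ p q) i j
    have hsplit : (fun B => (G B).Q p q) = fun B => (F B).Q p q + ((G B).Q p q - (F B).Q p q) := by
      funext B; ring
    simp only [Family.d2Q, Matrix.of_apply]
    rw [hsplit, hessianAt_add h1 h2, h3, add_zero]
  have hd2Δ : ∀ i j, G.d2Δ i j = F.d2Δ i j := by
    intro i j; ext p q
    have h1 : ContDiffAt ℝ 2 (fun B => (F B).Δ p q) 0 := hFΔ p q
    have h2 : ContDiffAt ℝ 2 (fun B => (G B).Δ p q - (F B).Δ p q) 0 := (hΔ p q).1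
    have h3 : hessianAt (fun B => (G B).Δ p q - (F B).Δ p q) i j = 0 := hessianAt_eq_zero_of_jet2Zero (hΔ p q) i j
    have hsplit : (fun B => (G B).Δ p q) = fun B => (F B).Δ p q + ((G B).Δ p q - (F B).Δ p q) := by
      funext B; ring
    simp only [Family.d2Δ, Matrix.of_apply]
    rw [hsplit, hessianAt_add h1 h2, h3, add_zero]
  have hdK : ∀ i, G.dK i = F.dK i := fun i => by rw [Family.dK_eq_fromBlocks, Family.dK_eq_fromBlocks, hdQ, hdΔ]
  have hd2K : ∀ i j, G.d2K i j = F.d2K i j := fun i j => by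
    rw [Family.d2K_eq_fromBlocks, Family.d2K_eq_fromBlocks, hd2Q, hd2Δ]
  funext i j
  rw [Family.polarization_eq_trace F hFQ hFΔ hdet, Family.polarization_eq_trace G hGQ hGΔ hdetG, hK0, hdK, hdK, hd2K]

end TwoJet

/-! ## §4. The projector family: exact clauses from any `C²` left inverse of the directions -/

section Projector

variable {n m r : ℕ}

/-- [folklore] The oblique projector `Π(B) = 1 − W(B)·L(B)` along the directions (`Π·W = 0` whenever `L·W = 1`). -/
def proj (W : (ι → ℝ) → Matrix (Fin n) (Fin r) ℝ) (L : (ι → ℝ) → Matrix (Fin r) (Fin n) ℝ) (B : ι → ℝ) :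
    Matrix (Fin n) (Fin n) ℝ :=
  1 - W B * L B

/-- [folklore] The PROJECTOR FAMILY `(Q·Π, Πᵀ·Δ·Π)`. -/
def projFamily (F : Family ι n m) (W : (ι → ℝ) → Matrix (Fin n) (Fin r) ℝ) (L : (ι → ℝ) → Matrix (Fin r) (Fin n) ℝ) :
    Family ι n m :=
  fun B => ⟨(F B).Q * proj W L B, (proj W L B)ᵀ * (F B).Δ * proj W L B⟩

variable (F : Family ι n m) (W : (ι → ℝ) → Matrix (Fin n) (Fin r) ℝ) (L : (ι → ℝ) → Matrix (Fin r) (Fin n) ℝ)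

omit [Fintype ι] [DecidableEq ι] in
/-- [folklore] `Π·W = 0`. -/
theorem proj_mul_W (hLW : ∀ B, L B * W B = 1) (B : ι → ℝ) : proj W L B * W B = 0 := by
  rw [proj, Matrix.sub_mul, Matrix.one_mul, Matrix.mul_assoc, hLW, Matrix.mul_one, sub_self]

omit [Fintype ι] [DecidableEq ι] in
/-- [folklore] (c1) for the projector family, EXACTLY at every background. -/
theorem projFamily_Δ_mul_W (hLW : ∀ B, L B * W B = 1) (B : ι → ℝ) : (projFamily F W L B).Δ * W B = 0 := by
  show (proj W L B)ᵀ * (F B).Δ * proj W L B * W B = 0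
  rw [Matrix.mul_assoc, proj_mul_W W L hLW, Matrix.mul_zero]

omit [Fintype ι] [DecidableEq ι] in
/-- [folklore] (c1), transposed side, EXACTLY. -/
theorem projFamily_Δ_transpose_mul_W (hLW : ∀ B, L B * W B = 1) (B : ι → ℝ) : (projFamily F W L B).Δᵀ * W B = 0 := by
  show ((proj W L B)ᵀ * (F B).Δ * proj W L B)ᵀ * W B = 0
  rw [Matrix.transpose_mul, Matrix.transpose_mul, Matrix.transpose_transpose, ← Matrix.mul_assoc, Matrix.mul_assoc,
    proj_mul_W W L hLW, Matrix.mul_zero]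

omit [Fintype ι] [DecidableEq ι] in
/-- [folklore] (c2) for the projector family, EXACTLY. -/
theorem projFamily_Q_mul_W (hLW : ∀ B, L B * W B = 1) (B : ι → ℝ) : (projFamily F W L B).Q * W B = 0 := by
  show (F B).Q * proj W L B * W B = 0
  rw [Matrix.mul_assoc, proj_mul_W W L hLW, Matrix.mul_zero]

omit [Fintype ι] [DecidableEq ι] in
/-- [folklore] The form of the projector family differs from `Δ` by three terms, each with a factor `Δ·W` or `Δᵀ·W`. -/
theorem projFamily_Δ_sub (B : ι → ℝ) :
    (projFamily F W L B).Δ - (F B).Δ =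
      -((F B).Δ * W B * L B) - (L B)ᵀ * ((F B).Δᵀ * W B)ᵀ + (L B)ᵀ * ((W B)ᵀ * ((F B).Δ * W B)) * L B := by
  show (1 - W B * L B)ᵀ * (F B).Δ * (1 - W B * L B) - (F B).Δ = _
  rw [Matrix.transpose_sub, Matrix.transpose_one, Matrix.transpose_mul, Matrix.transpose_mul, Matrix.transpose_transpose]
  simp only [Matrix.sub_mul, Matrix.mul_sub, Matrix.one_mul, Matrix.mul_one, Matrix.mul_assoc]
  abel

omit [Fintype ι] [DecidableEq ι] in
/-- [folklore] The constraint of the projector family differs from `Q` by `−(Q·W)·L`. -/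
theorem projFamily_Q_sub (B : ι → ℝ) : (projFamily F W L B).Q - (F B).Q = -((F B).Q * W B * L B) := by
  show (F B).Q * (1 - W B * L B) - (F B).Q = _
  rw [Matrix.mul_sub, Matrix.mul_one, Matrix.mul_assoc]
  abel

variable {F W L}

omit [DecidableEq ι] in
/-- [folklore] The projector is `C²` when `W`, `L` are. -/
theorem entryC2_proj (hW : EC2[W]) (hL : EC2[L]) : EC2[proj W L] := by
  intro i j
  have h := entryC2_mul hW hL i j
  have hc : ContDiffAt ℝ 2 (fun _ : ι → ℝ => (1 : Matrix (Fin n) (Fin n) ℝ) i j) 0 := contDiffAt_const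
  simpa [proj, Matrix.sub_apply] using hc.sub h

omit [DecidableEq ι] in
/-- [folklore] `C²` data ⇒ the projector family's constraint is `C²`. -/
theorem entryC2_projFamily_Q (hQ : EC2[fun B => (F B).Q]) (hW : EC2[W]) (hL : EC2[L]) : EC2[fun B => (projFamily F W L B).Q] :=
  entryC2_mul hQ (entryC2_proj hW hL)

omit [DecidableEq ι] in
/-- [folklore] `C²` data ⇒ the projector family's form is `C²`. -/
theorem entryC2_projFamily_Δ (hΔ : EC2[fun B => (F B).Δ]) (hW : EC2[W]) (hL : EC2[L]) : EC2[fun B => (projFamily F W L B).Δ] := by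
  have hPr := entryC2_proj hW hL
  have hPrt : EC2[fun B => (proj W L B)ᵀ] := fun i j => hPr j i
  exact entryC2_mul (entryC2_mul hPrt hΔ) hPr

omit [DecidableEq ι] in
/-- [folklore] JET CLAUSES ⇒ the projector family's form has the same 2-jet as `Δ` at `0`. -/
theorem entryJet2Zero_projFamily_Δ_sub (hW : EC2[W]) (hL : EC2[L])
    (c1 : EJ2Z[fun B => (F B).Δ * W B]) (c1t : EJ2Z[fun B => (F B).Δᵀ * W B]) :
    EJ2Z[fun B => (projFamily F W L B).Δ - (F B).Δ] := by
  have hLt : EC2[fun B => (L B)ᵀ] := fun i j => hL j i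
  have hWt : EC2[fun B => (W B)ᵀ] := fun i j => hW j i
  have t1 : EJ2Z[fun B => -((F B).Δ * W B * L B)] := fun i j => jet2Zero_neg (entryJet2Zero_mul_right c1 hL i j)
  have c1tt : EJ2Z[fun B => ((F B).Δᵀ * W B)ᵀ] := fun i j => c1t j i
  have t2 : EJ2Z[fun B => (L B)ᵀ * ((F B).Δᵀ * W B)ᵀ] := entryJet2Zero_mul_left hLt c1tt
  have t3a : EJ2Z[fun B => (W B)ᵀ * ((F B).Δ * W B)] := entryJet2Zero_mul_left hWt c1
  have t3b : EJ2Z[fun B => (L B)ᵀ * ((W B)ᵀ * ((F B).Δ * W B))] := entryJet2Zero_mul_left hLt t3a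
  have t3 : EJ2Z[fun B => (L B)ᵀ * ((W B)ᵀ * ((F B).Δ * W B)) * L B] := entryJet2Zero_mul_right t3b hL
  intro i j
  have h := jet2Zero_add (jet2Zero_sub (t1 i j) (t2 i j)) (t3 i j)
  have e : (fun B => ((projFamily F W L B).Δ - (F B).Δ) i j) =
      fun B => (-((F B).Δ * W B * L B) - (L B)ᵀ * ((F B).Δᵀ * W B)ᵀ + (L B)ᵀ * ((W B)ᵀ * ((F B).Δ * W B)) * L B) i j := by
    funext B; rw [projFamily_Δ_sub]
  rw [e]
  simpa [Matrix.add_apply, Matrix.sub_apply] using h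

omit [DecidableEq ι] in
/-- [folklore] JET CLAUSES ⇒ the projector family's constraint has the same 2-jet as `Q` at `0`. -/
theorem entryJet2Zero_projFamily_Q_sub (hL : EC2[L]) (c2 : EJ2Z[fun B => (F B).Q * W B]) :
    EJ2Z[fun B => (projFamily F W L B).Q - (F B).Q] := by
  have t : EJ2Z[fun B => -((F B).Q * W B * L B)] := fun i j => jet2Zero_neg (entryJet2Zero_mul_right c2 hL i j)
  intro i j
  have e : (fun B => ((projFamily F W L B).Q - (F B).Q) i j) = fun B => (-((F B).Q * W B * L B)) i j := by
    funext B; rw [projFamily_Q_sub]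
  rw [e]
  exact t i j

end Projector

end Summit.QuantumFields.BalabanUV.Beta.TwoJetPolarization

end
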